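import Mathlib
import HarnessLib
import Literature.Probability.LatticeModels.ProdBernoulliCoupling
import Literature.Probability.LatticeModels.LatticeGraph

/-!
# Stub `stub_floorCoupling` of crux `LowPointBookkeeping` (stmt-CriticalPhenomena-14713), part 1: label coupling

Helper file 1/4 for the registered stub `stub_floorCoupling` of the line SketchIdeator1 (skeleton
`Cruxes/LowPointBookkeeping/Lines/SketchIdeator1.lean`); lands `--supports stmt-CriticalPhenomena-14713` with the
registered def-free sub-goal `stub_floorCouplingLabels`.

Generic facts about i.i.d. uniform labels `U : ι → ℝ` (law `unifLabels ι`, the infinite product of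
`Leb|[0,1]`): resampling one coordinate, level configurations `{i | U i ≤ level}` and their laws
(`prodBernoulli`), almost-sure positivity and distinctness of labels, and the discrete pivot lemma
for a finite chain of configurations.
-/

noncomputable section

namespace Summit.CriticalPhenomena.PercolationContinuityZ3.Theorems.FloorRusso.Coupling

open MeasureTheory Measure Set
open Literature.Probability.LatticeModels
open scoped ENNReal

variable {ι : Type*}

/-- The one-coordinate label law `Leb|[0,1]` (a `def`, so that the probability instance below is keyed
on it and does not leak to Mathlib terms). -/
def unif : Measure ℝ := (volume : Measure ℝ).restrict (Icc (0 : ℝ) 1)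

/-- `instance` (helper, see the module docstring). -/
instance : IsProbabilityMeasure unif := ⟨by simp [unif, Real.volume_Icc]⟩

/-- The law of i.i.d. uniform `[0,1]` labels on `ι`. -/
abbrev unifLabels (ι : Type*) : Measure (ι → ℝ) := infinitePi fun _ : ι => unif

/-- **Resampling one coordinate**: replacing the `f`-th label by an independent uniform label does
not change the joint law. -/
theorem map_update_prod_unifLabels [DecidableEq ι] (f : ι) :
    (unif.prod (unifLabels ι)).map (fun p : ℝ × (ι → ℝ) => Function.update p.2 f p.1) =
      unifLabels ι := by
  have hmeas : Measurable fun p : ℝ × (ι → ℝ) => Function.update p.2 f p.1 :=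
    measurable_pi_lambda _ fun i => by
      by_cases hi : i = f
      · subst hi; simpa using measurable_fst
      · simp only [Function.update_of_ne hi]; exact (measurable_pi_apply i).comp measurable_snd
  refine eq_infinitePi _ fun s t ht => ?_
  rw [Measure.map_apply hmeas (MeasurableSet.pi s.countable_toSet fun i _ => ht i)]
  have hpre : (fun p : ℝ × (ι → ℝ) => Function.update p.2 f p.1) ⁻¹' Set.pi (↑s) t =
      (if f ∈ s then t f else univ) ×ˢ Set.pi (↑(s.erase f)) t := by
    ext ⟨x, U⟩
    simp only [mem_preimage, mem_pi, Finset.mem_coe, mem_prod, Finset.mem_erase]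
    constructor
    · intro h
      refine ⟨?_, fun i hi => ?_⟩
      · split_ifs with hf
        · simpa using h f hf
        · exact mem_univ _
      · have := h i hi.2
        rwa [Function.update_of_ne hi.1] at this
    · rintro ⟨hx, hU⟩ i hi
      by_cases hif : i = f
      · subst hif; simpa [hi] using hx
      · rw [Function.update_of_ne hif]; exact hU i ⟨hif, hi⟩
  rw [hpre, Measure.prod_prod, infinitePi_pi _ (fun i _ => ht i)]
  by_cases hf : f ∈ s
  · rw [if_pos hf, ← Finset.mul_prod_erase s _ hf]
  · rw [if_neg hf, measure_univ, one_mul, Finset.erase_eq_of_notMem hf]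

/-! ### Level configurations -/

section Levels

variable (F : Set ι) (c : ι → unitInterval)

open scoped Classical in
/-- The level of coordinate `i` at floor level `t`: `t` on `F`, the base level `c i` off `F`. -/
def lv (t : ℝ) (i : ι) : ℝ := if i ∈ F then t else (c i : ℝ)

/-- The level configuration `θ_t(U) = {i | U i ≤ lv t i}`. -/
def levelCfg (t : ℝ) (U : ι → ℝ) : Set ι := {i | U i ≤ lv F c t i}

/-- The level configuration with coordinate `f` removed: `{i ≠ f | U i ≤ lv t i}`. -/
def levelCfgOff (f : ι) (t : ℝ) (U : ι → ℝ) : Set ι := {i | i ≠ f ∧ U i ≤ lv F c t i}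

open scoped Classical in
/-- The levels as points of `[0,1]` (for `t ∈ [0,1]`): `lvI t i = lv t i`. -/
def lvI (t : unitInterval) (i : ι) : unitInterval := if i ∈ F then t else c i

variable {F c}

/-- `lv_of_mem` (helper, see the module docstring). -/
theorem lv_of_mem {i : ι} (hi : i ∈ F) (t : ℝ) : lv F c t i = t := by simp [lv, hi]

/-- `lv_of_not_mem` (helper, see the module docstring). -/
theorem lv_of_not_mem {i : ι} (hi : i ∉ F) (t : ℝ) : lv F c t i = c i := by simp [lv, hi]

/-- `coe_lvI` (helper, see the module docstring). -/
theorem coe_lvI (t : unitInterval) (i : ι) : (lvI F c t i : ℝ) = lv F c t i := by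
  by_cases hi : i ∈ F <;> simp [lvI, lv, hi]

/-- `lv_mono` (helper, see the module docstring). -/
theorem lv_mono {t t' : ℝ} (h : t ≤ t') (i : ι) : lv F c t i ≤ lv F c t' i := by
  by_cases hi : i ∈ F
  · simpa [lv_of_mem hi] using h
  · simp [lv_of_not_mem hi]

/-- `mem_levelCfg_iff` (helper, see the module docstring). -/
theorem mem_levelCfg_iff {t : ℝ} {U : ι → ℝ} {i : ι} : i ∈ levelCfg F c t U ↔ U i ≤ lv F c t i :=
  Iff.rfl

/-- `mem_levelCfgOff_iff` (helper, see the module docstring). -/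
theorem mem_levelCfgOff_iff {f : ι} {t : ℝ} {U : ι → ℝ} {i : ι} :
    i ∈ levelCfgOff F c f t U ↔ i ≠ f ∧ U i ≤ lv F c t i := Iff.rfl

/-- The level configurations increase with the level. -/
theorem levelCfg_mono {t t' : ℝ} (h : t ≤ t') (U : ι → ℝ) : levelCfg F c t U ⊆ levelCfg F c t' U :=
  fun i (hi : U i ≤ lv F c t i) => hi.trans (lv_mono h i)

/-- Off `F` the membership does not depend on the level. -/
theorem mem_levelCfg_of_not_mem {i : ι} (hi : i ∉ F) (t t' : ℝ) (U : ι → ℝ) :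
    i ∈ levelCfg F c t U ↔ i ∈ levelCfg F c t' U := by
  simp [mem_levelCfg_iff, lv_of_not_mem hi]

/-- On `F` the membership is `U f ≤ t`. -/
theorem mem_levelCfg_of_mem {f : ι} (hf : f ∈ F) (t : ℝ) (U : ι → ℝ) :
    f ∈ levelCfg F c t U ↔ U f ≤ t := by
  simp [mem_levelCfg_iff, lv_of_mem hf]

/-- `levelCfgOff_subset` (helper, see the module docstring). -/
theorem levelCfgOff_subset (f : ι) (t : ℝ) (U : ι → ℝ) : levelCfgOff F c f t U ⊆ levelCfg F c t U :=
  fun _ hi => hi.2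

/-- `not_mem_levelCfgOff` (helper, see the module docstring). -/
theorem not_mem_levelCfgOff (f : ι) (t : ℝ) (U : ι → ℝ) : f ∉ levelCfgOff F c f t U :=
  fun h => h.1 rfl

/-- `levelCfg_diff_singleton` (helper, see the module docstring). -/
theorem levelCfg_diff_singleton (f : ι) (t : ℝ) (U : ι → ℝ) :
    levelCfg F c t U \ {f} = levelCfgOff F c f t U := by
  ext i; simp only [mem_sdiff, mem_levelCfg_iff, mem_singleton_iff, mem_levelCfgOff_iff]; tauto

/-- Resampling the `f`-th label at the current floor level `t` puts `f` in and leaves the rest. -/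
theorem levelCfg_update [DecidableEq ι] {f : ι} (hf : f ∈ F) (t : ℝ) (U : ι → ℝ) :
    levelCfg F c t (Function.update U f t) = insert f (levelCfgOff F c f t U) := by
  ext i
  simp only [mem_levelCfg_iff, mem_insert_iff, mem_levelCfgOff_iff]
  by_cases hi : i = f
  · subst hi; simp [lv_of_mem hf]
  · simp [hi]

/-- `levelCfgOff_update` (helper, see the module docstring). -/
theorem levelCfgOff_update [DecidableEq ι] (f : ι) (t s : ℝ) (U : ι → ℝ) :
    levelCfgOff F c f t (Function.update U f s) = levelCfgOff F c f t U := by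
  ext i
  simp only [mem_levelCfgOff_iff]
  by_cases hi : i = f
  · simp [hi]
  · simp [hi]

/-- **Law of the level configuration**: `θ_t(U)` has law `prodBernoulli (lvI t)` (`t ∈ [0,1]`). -/
theorem map_levelCfg_unifLabels (t : unitInterval) :
    (unifLabels ι).map (levelCfg F c (t : ℝ)) = prodBernoulli (lvI F c t) := by
  rw [prodBernoulli_eq_map_labels]
  congr 1
  funext U
  ext i
  simp [mem_levelCfg_iff, coe_lvI]

/-- Measurability of `U ↦ θ_t(U)`. -/
theorem measurable_levelCfg (t : ℝ) : Measurable (levelCfg F c t : (ι → ℝ) → Set ι) :=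
  measurable_set_iff.2 fun i =>
    (show Measurable fun x : ℝ => (x ≤ lv F c t i) from
      measurableSet_setOf.1 measurableSet_Iic).comp (measurable_pi_apply i)

/-- Joint measurability of `(t, U) ↦ θ^f_t(U)` (level configuration off `f`). -/
theorem measurable_levelCfgOff_uncurry (f : ι) :
    Measurable fun p : ℝ × (ι → ℝ) => levelCfgOff F c f p.1 p.2 := by
  refine measurable_set_iff.2 fun i => ?_
  by_cases hif : i = f
  · have : (fun p : ℝ × (ι → ℝ) => i ∈ levelCfgOff F c f p.1 p.2) = fun _ => False := by
      funext p; exact propext ⟨fun h => h.1 hif, False.elim⟩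
    rw [this]; exact measurable_const
  · by_cases hiF : i ∈ F
    · have : (fun p : ℝ × (ι → ℝ) => i ∈ levelCfgOff F c f p.1 p.2) = fun p => p.2 i ≤ p.1 := by
        funext p; exact propext ⟨fun h => by simpa [lv_of_mem hiF] using h.2,
          fun h => ⟨hif, by simpa [lv_of_mem hiF] using h⟩⟩
      rw [this]
      exact measurableSet_setOf.1
        (measurableSet_le ((measurable_pi_apply i).comp measurable_snd) measurable_fst)
    · have : (fun p : ℝ × (ι → ℝ) => i ∈ levelCfgOff F c f p.1 p.2) =
          fun p => p.2 i ≤ (c i : ℝ) := by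
        funext p; exact propext ⟨fun h => by simpa [lv_of_not_mem hiF] using h.2,
          fun h => ⟨hif, by simpa [lv_of_not_mem hiF] using h⟩⟩
      rw [this]
      exact measurableSet_setOf.1
        (measurableSet_le ((measurable_pi_apply i).comp measurable_snd) measurable_const)

/-- `measurable_levelCfgOff` (helper, see the module docstring). -/
theorem measurable_levelCfgOff (f : ι) (t : ℝ) :
    Measurable (levelCfgOff F c f t : (ι → ℝ) → Set ι) :=
  (measurable_levelCfgOff_uncurry f).comp (measurable_const.prodMk measurable_id)

end Levels

/-! ### Almost sure properties of the labels -/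

section AlmostSure

variable [Countable ι]

/-- Each label lies in `(0, 1]` almost surely; in particular it is positive. -/
theorem ae_forall_pos : ∀ᵐ U ∂unifLabels ι, ∀ i : ι, 0 < U i := by
  rw [ae_all_iff]
  intro i
  have hm : MeasurableSet {x : ℝ | ¬ 0 < x} := (measurableSet_lt measurable_const measurable_id).compl
  have hnull : unif {x : ℝ | ¬ 0 < x} = 0 := by
    have : {x : ℝ | ¬ 0 < x} ∩ Icc 0 1 ⊆ {0} := by
      rintro x ⟨hx, hx0, -⟩
      exact le_antisymm (not_lt.1 hx) hx0
    rw [unif, Measure.restrict_apply' measurableSet_Icc]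
    exact measure_mono_null this (by simp)
  have : unifLabels ι ((Function.eval i) ⁻¹' {x : ℝ | ¬ 0 < x}) = 0 := by
    rw [(measurePreserving_eval_infinitePi (fun _ : ι => unif) i).measure_preimage
      hm.nullMeasurableSet]
    exact hnull
  exact (measure_eq_zero_iff_ae_notMem.1 this).mono fun U hU => not_not.1 hU

omit [Countable ι] in
/-- Two distinct coordinates have distinct labels almost surely. -/
theorem ae_ne_of_ne {i j : ι} (hij : i ≠ j) : ∀ᵐ U ∂unifLabels ι, U i ≠ U j := by
  have hm : MeasurableSet {p : ℝ × ℝ | p.1 = p.2} := measurableSet_eq_fun measurable_fst measurable_snd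
  have hdiag : (unif.prod unif) {p : ℝ × ℝ | p.1 = p.2} = 0 := by
    rw [Measure.prod_apply hm]
    simp only [preimage_setOf_eq]
    have hpt : ∀ x : ℝ, unif {x} = 0 := fun x => by simp [unif]
    simp [hpt]
  have hmeas : Measurable fun U : ι → ℝ => (U i, U j) :=
    (measurable_pi_apply i).prodMk (measurable_pi_apply j)
  have : unifLabels ι ((fun U : ι → ℝ => (U i, U j)) ⁻¹' {p : ℝ × ℝ | p.1 = p.2}) = 0 := by
    rw [← Measure.map_apply hmeas hm, Measure.infinitePi_map_eval_prod (P := fun _ : ι => unif) hij]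
    exact hdiag
  exact measure_eq_zero_iff_ae_notMem.1 this

/-- All labels on a countable family are pairwise distinct almost surely. -/
theorem ae_injOn (F : Set ι) : ∀ᵐ U ∂unifLabels ι, Set.InjOn U F := by
  have : ∀ᵐ U ∂unifLabels ι, ∀ i j : ι, i ≠ j → U i ≠ U j := by
    rw [ae_all_iff]; intro i; rw [ae_all_iff]; intro j
    by_cases hij : i = j
    · exact Filter.Eventually.of_forall fun U h => (h hij).elim
    · exact (ae_ne_of_ne hij).mono fun U h _ => h
  exact this.mono fun U hU i _ j _ h => by_contra fun hij => hU i j hij h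

end AlmostSure

/-! ### The discrete pivot lemma -/

/-- **Discrete pivot lemma.** If `ω₀ ∉ A`, `ω₀ ∪ Δ ∈ A` for an event `A` and a finite `Δ` on
which the labels `U` are injective, then some `d ∈ Δ` is pivotal at its own label: adding to `ω₀`
the elements of `Δ` with label `≤ U d` gives a configuration in `A`, with label `< U d` one not in `A`. -/
theorem exists_pivot_of_chain (A : Set (Set ι)) (U : ι → ℝ) (ω₀ : Set ι)
    (Δ : Finset ι) (hinj : Set.InjOn U ↑Δ) (h0 : ω₀ ∉ A) (h1 : ω₀ ∪ ↑Δ ∈ A) :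
    ∃ d ∈ Δ, ω₀ ∪ {d' | d' ∈ Δ ∧ U d' ≤ U d} ∈ A ∧ ω₀ ∪ {d' | d' ∈ Δ ∧ U d' < U d} ∉ A := by
  classical
  -- induction on `Δ` adding elements in increasing label order
  induction Δ using Finset.induction_on_max_value U with
  | empty => simp at h1; exact absurd h1 h0
  | insert a s has hmax ih =>
    have hinj_s : Set.InjOn U ↑s := hinj.mono (by simp)
    by_cases hs : ω₀ ∪ ↑s ∈ A
    · obtain ⟨d, hd, hin, hout⟩ := ih hinj_s hs
      have hda : U d < U a := by
        refine lt_of_le_of_ne (hmax d hd) fun h => ?_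
        have := hinj (by simp [hd]) (by simp) h
        exact has (this ▸ hd)
      refine ⟨d, Finset.mem_insert_of_mem hd, ?_, ?_⟩
      · have : {d' | d' ∈ insert a s ∧ U d' ≤ U d} = {d' | d' ∈ s ∧ U d' ≤ U d} := by
          ext d'
          simp only [Finset.mem_insert, mem_setOf_eq]
          constructor
          · rintro ⟨rfl | h, h'⟩
            · exact absurd h' (not_le.2 hda)
            · exact ⟨h, h'⟩
          · rintro ⟨h, h'⟩; exact ⟨Or.inr h, h'⟩
        rw [this]; exact hin
      · have : {d' | d' ∈ insert a s ∧ U d' < U d} = {d' | d' ∈ s ∧ U d' < U d} := by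
          ext d'
          simp only [Finset.mem_insert, mem_setOf_eq]
          constructor
          · rintro ⟨rfl | h, h'⟩
            · exact absurd (h'.trans hda) (lt_irrefl _)
            · exact ⟨h, h'⟩
          · rintro ⟨h, h'⟩; exact ⟨Or.inr h, h'⟩
        rw [this]; exact hout
    · refine ⟨a, Finset.mem_insert_self a s, ?_, ?_⟩
      · have : {d' | d' ∈ insert a s ∧ U d' ≤ U a} = ↑(insert a s) := by
          ext d'
          simp only [Finset.mem_insert, mem_setOf_eq, Finset.coe_insert, mem_insert_iff, Finset.mem_coe]
          constructor
          · exact fun h => h.1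
          · rintro (rfl | h)
            · exact ⟨Or.inl rfl, le_rfl⟩
            · exact ⟨Or.inr h, hmax d' h⟩
        rw [this]; exact h1
      · have : {d' | d' ∈ insert a s ∧ U d' < U a} = ↑s := by
          ext d'
          simp only [Finset.mem_insert, mem_setOf_eq, Finset.mem_coe]
          constructor
          · rintro ⟨rfl | h, h'⟩
            · exact absurd h' (lt_irrefl _)
            · exact h
          · intro h
            refine ⟨Or.inr h, lt_of_le_of_ne (hmax d' h) fun he => ?_⟩
            have := hinj (by simp [h]) (by simp) he
            exact has (this ▸ h)
        rw [this]; exact hs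

/-! ### Level configurations for an arbitrary level vector -/

/-- The configuration `{i | U i ≤ P i}` for a level vector `P : ι → [0,1]`. -/
def lcfg (P : ι → unitInterval) (U : ι → ℝ) : Set ι := {i | U i ≤ (P i : ℝ)}

/-- `mem_lcfg_iff` (helper, see the module docstring). -/
theorem mem_lcfg_iff {P : ι → unitInterval} {U : ι → ℝ} {i : ι} : i ∈ lcfg P U ↔ U i ≤ (P i : ℝ) :=
  Iff.rfl

/-- **Law of `{i | U i ≤ P i}`** is `prodBernoulli P` (the labels coupling). -/
theorem map_lcfg_unifLabels (P : ι → unitInterval) : (unifLabels ι).map (lcfg P) = prodBernoulli P :=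
  (prodBernoulli_eq_map_labels P).symm

/-- `measurable_lcfg` (helper, see the module docstring). -/
theorem measurable_lcfg (P : ι → unitInterval) : Measurable (lcfg P : (ι → ℝ) → Set ι) :=
  measurable_set_iff.2 fun i =>
    (show Measurable fun x : ℝ => (x ≤ (P i : ℝ)) from
      measurableSet_setOf.1 measurableSet_Iic).comp (measurable_pi_apply i)

/-- `unifLabels_preimage_lcfg` (helper, see the module docstring). -/
theorem unifLabels_preimage_lcfg (P : ι → unitInterval) {E : Set (Set ι)} (hE : MeasurableSet E) :
    unifLabels ι ((lcfg P) ⁻¹' E) = prodBernoulli P E := by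
  rw [← map_lcfg_unifLabels, Measure.map_apply (measurable_lcfg P) hE]

/-- **Registered sub-goal `stub_floorCouplingLabels`** (def-free form of `map_update_prod_unifLabels`):
resampling one coordinate of an i.i.d. uniform family by an independent uniform label preserves the
product law. -/
theorem stub_floorCouplingLabels :
    ∀ (f : Sym2 (Site 3)),
      (((volume : Measure ℝ).restrict (Set.Icc (0 : ℝ) 1)).prod
          (Measure.infinitePi fun _ : Sym2 (Site 3) => (volume : Measure ℝ).restrict (Set.Icc (0 : ℝ) 1))).map
        (fun p : ℝ × (Sym2 (Site 3) → ℝ) => Function.update p.2 f p.1) =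
      Measure.infinitePi fun _ : Sym2 (Site 3) => (volume : Measure ℝ).restrict (Set.Icc (0 : ℝ) 1) := by
  classical
  intro f
  exact map_update_prod_unifLabels f

end Summit.CriticalPhenomena.PercolationContinuityZ3.Theorems.FloorRusso.Coupling

end
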